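import Summits.AtomisticToContinuum.Crystallization.Theorems.FrustratedLawDichotomyStrainedPatchTaylorKbandMinusD

/-!
(SPLIT FOR THE 400-LINE CAP by the landing lane, hand-2 g29: this file = part A (table types, §0 (F3) splits, §1 force cap); part B = `…StrainedPatchQuantSlaving` (§2–§5) imports it; same namespace, all FQNs unchanged.)
# «QuantSlaving» — the force-polytope ENCLOSURE architecture behind (LINᴾ⁻)/(BASᴾ-fix), the force cap typed, (F3) split by host class
# (27623 strained-patch piece, T-side [CORE-FAR]; decomp-a2c lens-5 «finite range + asymptotic regime + bridge», generation 57; critic rows 1050 (i)(iii), 1051 (B))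

(Imports lens-5 g56 `…TaylorKbandMinusD` (record of record `coreOff_record_g56_splitFix ηP`: passing class `𝓘₀ᴾ(ηP)` by (BASᴾ-fix) · (MEMᴾ-fix μ) · (LINᴾ⁻ Ψ),
rough class `𝓘₀ꟴ(ηP)` one open (F1-law) binder, (F2-bent₀), (F3ᴰ), [BRIDGE], [SOFT-FAR]).)

WHAT THE CENSUS MEASURED (OUTER30-METHOD, critic row 1051).  Every instrument behind (BAS)/(LIN) so far optimised over the LINEAR one-move polytope
`P_lin = {u : |F⁽⁰⁾ + H u| ≤ σ₁ on the reach, pins on the rim}`; the binders quantify over the TRUE admissible set `A = {u : |F(u)| ≤ σ₁}` and `A ⊄ P_lin` (HM62: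
true reach force `3.6 σ₁` at the LP vertex).  An outer bound needs `A ∩ tube ⊆ P(κ) := {u : |F⁽⁰⁾ + H u| ≤ (1+κ)σ₁ + X}`; structure-free Taylor gives `κ ≈ 287` on the
`δ₀ = 1/20` tube (rows void), and the structure-free contraction `κ ↦ sup_{P(κ)} |R|/σ₁` has NO fixed point at any host (needs strain `≤ 0.00148`, realised `0.004–0.032`).
The critic's idea node «QuantSlavingIFT» (row 1051 (B)) = a quantitative slaving / IFT with a STRUCTURED second-order remainder.  This file TYPES that node so that
its instrumentable, analytic and bridge parts are separate items, and proves every seam: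

§0 (critic row 1050 (i)) ★ (F3) SPLITS over a host class — `familyCert_of_split` (same table; antitonicity is the tree's `FamilyCert.anti_family`) and, with per-class tables glued by `splitTable`,
   `familyCert_of_split_tables` / `familyEnvelopeLaw_of_split_tables`; the per-class-table record `coreOff_record_g57s` ((F3ᴾ) on `𝓘₀ᴾ` with `Ψ_P + ϱ₀ + μ_P`,
   (F3ꟴ) on `𝓘₀ꟴ` with its own `Φ_Q`) — the inter-class coupling through ONE `FamilyCertD (withColumns Ψ μ)` noted in row 1050 is gone.
§1 THE FORCE CAP TYPED — `ljD1`/`ljD2` (closed forms of `V'`, `V''` of the tree's `lennardJones`), the move-test neighbourhood `moveNbrs` and local field `locField`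
   (literally the sums inside `MoveUnstableCore`), the site force `siteForce Rm y j = −∇ locField`, reach sites `IsReach` (complement of the tree's `uncapped` in the
   ball: `isReach_or_mem_uncapped`, `not_mem_uncapped_of_isReach`, `mem_ball_of_isReach`), and ★ **(FC σ) `ForceCapLaw σ`** [ATTACKABLE · KNOWN-MATH, M]: every reach
   site of an admissible cluster has `‖siteForce 7 z a‖ ≤ σ`; TRUE at `σ = σ₁` (the `s → 0` slope of `¬MoveUnstableCore 0 7 s`, which non-exemption grants on the
   whole reach for every `s ∈ [0, 3/2]`; `Sep`/injectivity make `locField` smooth at `z a`; cf. the tree's `…NashForceBalance.hasFDerivAt_lennardJones_dist`).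
§2 THE LINEAR FORCE MODEL AS TABLES — `pairHess` (the LJ pair Hessian as a continuous linear map), the designated TRUE tables `hessBlk0` (Hessian blocks of the
   move-test forces at the instance) and `force0` (`siteForce 7` at the instance), the linearised force `linForce H F` through the chart, and
   ★ `InForcePolytope κ σ H F X` — the chart's deviation field satisfies the `κ`-INFLATED linear force rows `‖F(e a) + Σ H(e a, e a') dev a'‖ ≤ (1+κ)σ + X(e a)` at
   every reach site (`X ≥ 0` = the UNMODELLED part of the true row: exterior beyond the charted `63/10`-ball, uncovered partners, cutoff-shell mismatch — the
   census's g0a; `X ≡ 0` is only honest for a fully charted move neighbourhood).  Three pieces over any family / law / tables: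
   ★★ **(ENC κ) `SlavingEnclosure`** [ANALYTIC · UNDECIDED — the typed conclusion of «QuantSlavingIFT»]: admissible clean mono-phase `δ`-finely charted clusters lie in `P(κ)`;
   ★★ **(NEEDCERT κ Ψ) `NeedCert`** [INSTRUMENTABLE — a finite LP per instance, census (O1) `M_D^outer(κ)`; NO admissibility hypothesis]: charts in `P(κ)` have
   `−Ψ(z₀)(T z₀) ≤ lin_G − quad_w`;  ★ **(BASCERT δ₁ κ δ) `BasinCert`** [INSTRUMENTABLE in principle — census (O2); see the caveat in its docstring]: `δ₁`-fine charts
   in `P(κ)` are `δ`-fine.  Seams (all PROVED): `slavedLaw_of_enclosure` (ENC κ) ∧ (NEEDCERT κ Ψ) ⟹ (LIN-law Ψ); `basinFix_of_enclosure` (BAS-fix δ₁) ∧ (ENC at δ₁)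
   ∧ (BASCERT δ₁ κ δ) ⟹ (BAS-fix δ); `fineChart_of_chartBy` (the coarse clause IS `FineChart τ`) hence `basinFix_of_enclosure_coarse`; monotonicity in `κ`
   (`inForcePolytope_mono`, `slavingEnclosure_mono_kappa`, `needCert_anti_kappa`, `basinCert_anti_kappa`) and antitonicity in the family.
§3 THE BRIDGE (this lens) — ★ **(STEP κ κ') `RemainderStep`**: a `δ`-fine admissible chart in `P(κ)` is in `P(κ')` [ANALYTIC (Taylor identity) + INSTRUMENTABLE
   (a STRUCTURED sup bound of the second-order force remainder over the linear image `P(κ) ∩ tube`)]; ★★ `slavingEnclosure_of_chain`: (ENC κ₀) and finitely many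
   steps `κ₀ → κ₁ → … → κₙ` give (ENC κₙ) — finite instrumentable range + analytic regime + monotone bridge; the Taylor-remainder forms `ForceTaylorBound ρ`
   (a-priori, on the tube) / `ForceTaylorBoundIn κ ρ` (on the tube ∩ `P(κ)`) with ★ `slavingEnclosure_of_forceCap` (FC σ) ∧ (TFR κσ) ⟹ (ENC κ) and
   ★ `remainderStep_of_forceCap` (FC σ) ∧ (TFR-in κ (κ'σ)) ⟹ (STEP κ κ').
§4 RECORDS — ★★★★ `coreOff_record_g57e ηP κ`: [CORE-FAR] ⟸ (BASᴾ-fix) · (MEMᴾ-fix μ) · (ENCᴾ κ) · (NEEDCERTᴾ κ Ψ) · (F1-law on `𝓘₀ꟴ`) · (F2-bent₀) · (F3ᴰ) · [BRIDGE] ·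
   [SOFT-FAR] (the g56 designate with (LINᴾ⁻ Ψ) DECOMPOSED); ★★★★ `coreOff_record_g57c ηP k n`: the same with (ENCᴾ (k n)) replaced by (FC σ₁) · (TFRᴾ (k 0)·σ₁) ·
   the n steps (TFR-inᴾ (k i) ((k (i+1))·σ₁)); `coreOff_record_g57u` (whole family, no class split); `coreOff_record_g57s` (per-class certificate tables);
   `envelopeQ_of_enclosure` (the SAME architecture types the rough class: (F1-law on `𝓘₀ꟴ`) ⟸ (BASꟴ-fix) · (MEMꟴ-fix) · (ENCꟴ κ_Q) · (NEEDCERTꟴ κ_Q Ψ_Q), (T2⁻) a theorem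
   there too — one idea node for both classes, as row 1051 (B) rules).
§5 (critic row 1050 (iii)) the class threshold: membership of a host in `ClassP ηP` is DECIDED by `η_mm(centre) < ηP` (strict, `GoodAtScale`'s `η < ηmax`); the
   pin `etaP1 := 47/800 = 0.05875` sits midway between HE58 (`0.0578`, P) and HE60 (`0.0597`, Q) (`etaP1_window`); the record admits any `ηP`.

STRENGTH TAGS (doctrine (a)).  (FC σ₁): TRUE · ATTACKABLE NOW (M; first prover target).  (NEEDCERT): WEAKER than (LIN-law) [no mechanics; an LP fact about the
instance] · INSTRUMENTABLE · TRUE for `Ψ :=` the robust LP value — the numbers bite in (F3).  (ENC κ) at `δ₀`: UNDECIDED · not known to imply the summit · its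
structure-free sufficient condition is REFUTED numerically (OUTER30-METHOD §3) · its structured sufficient condition (the chain) is the CHEAPEST FALSIFIER: does a
few-step chain `300 → … → κ*` close with STRUCTURED constants at HZ00 (census ask OUTER30 (O3)/(O4), structured variant), with `κ*` at or below the K3 break-even of
(O1)?  (BASCERT τ … δ₀) from the COARSE tube: presumably FALSE/uncertifiable (no certainly-pinned rim site under `±1/4` set fuzz — memo §3 g0c); (BAS-fix δ₀) is
therefore NOT split here and stays ONE piece [ANALYTIC · IDEA-NEEDED «coarse-to-fine localisation under the force cap»; candidate lever: a nonlinear discrete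
maximum principle for force-capped clean LJ shells in the convex range of `V`, memo §4].  No piece is known equivalent to [CORE-FAR] or to the summit.
No `sorry`, no new axiom, no `instance`, no `notation`.
-/

namespace Summit.AtomisticToContinuum.Crystallization.Theorems.FrustratedLawDichotomyStrainedPatchQuantSlaving

open scoped BigOperators Classical
open Literature.MathematicalPhysics.StatisticalMechanics (lennardJones)
open Summit.AtomisticToContinuum.Crystallization.Theorems.FrustratedLawDichotomyPeriodicBlockFlags (goodAtScale_mono)
open Summit.AtomisticToContinuum.Crystallization.Theorems.FrustratedLawDichotomyRangeCut (Sep)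
open Summit.AtomisticToContinuum.Crystallization.Theorems.FrustratedLawDichotomyMotifLemmas
open Summit.AtomisticToContinuum.Crystallization.Theorems.FrustratedLawDichotomyAveragingCut
open Summit.AtomisticToContinuum.Crystallization.Theorems.FrustratedLawDichotomyAveragingRuleCap
open Summit.AtomisticToContinuum.Crystallization.Theorems.FrustratedLawDichotomyAveragingRuleTightFree
open Summit.AtomisticToContinuum.Crystallization.Theorems.FrustratedLawDichotomyStrainedPatchHomSplit
open Summit.AtomisticToContinuum.Crystallization.Theorems.FrustratedLawDichotomyStrainedPatchCleanCollar
open Summit.AtomisticToContinuum.Crystallization.Theorems.FrustratedLawDichotomyStrainedPatchHomIsometry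
open Summit.AtomisticToContinuum.Crystallization.Theorems.FrustratedLawDichotomyStrainedPatchHomTubeIso
open Summit.AtomisticToContinuum.Crystallization.Theorems.FrustratedLawDichotomyStrainedPatchPhaseCut
open Summit.AtomisticToContinuum.Crystallization.Theorems.FrustratedLawDichotomyStrainedPatchCoreTube
open Summit.AtomisticToContinuum.Crystallization.Theorems.FrustratedLawDichotomyStrainedPatchCoreTubeRecord
open Summit.AtomisticToContinuum.Crystallization.Theorems.FrustratedLawDichotomyStrainedPatchStrainBands
open Summit.AtomisticToContinuum.Crystallization.Theorems.FrustratedLawDichotomyStrainedPatchChartFamilies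
open Summit.AtomisticToContinuum.Crystallization.Theorems.FrustratedLawDichotomyStrainedPatchChartFamiliesBent
open Summit.AtomisticToContinuum.Crystallization.Theorems.FrustratedLawDichotomyStrainedPatchChartFamiliesPinned
open Summit.AtomisticToContinuum.Crystallization.Theorems.FrustratedLawDichotomyStrainedPatchEnvelopeLaw
open Summit.AtomisticToContinuum.Crystallization.Theorems.FrustratedLawDichotomyStrainedPatchEnvelopeTaylor
open Summit.AtomisticToContinuum.Crystallization.Theorems.FrustratedLawDichotomyStrainedPatchWindowFamilies
open Summit.AtomisticToContinuum.Crystallization.Theorems.FrustratedLawDichotomyStrainedPatchRecutPairs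
open Summit.AtomisticToContinuum.Crystallization.Theorems.FrustratedLawDichotomyStrainedPatchMembership
open Summit.AtomisticToContinuum.Crystallization.Theorems.FrustratedLawDichotomyStrainedPatchDirect
open Summit.AtomisticToContinuum.Crystallization.Theorems.FrustratedLawDichotomyStrainedPatchTaylorPairSigned
open Summit.AtomisticToContinuum.Crystallization.Theorems.FrustratedLawDichotomyStrainedPatchTaylorKbandMinus
open Summit.AtomisticToContinuum.Crystallization.Theorems.FrustratedLawDichotomyStrainedPatchTaylorKbandMinusD

/-! ## Table types (abbreviations only) -/

/-- Chart families `𝓘 M₀ z₀ c₀`. -/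
abbrev ChartFam := (M₀ : ℕ) → (Fin M₀ → E3) → Fin M₀ → Prop
/-- Room laws / columns `T(z₀)`, `μ(z₀)`. -/
abbrev LawTab := (M₀ : ℕ) → (Fin M₀ → E3) → Fin M₀ → ℝ
/-- Envelope moduli `Φ(z₀)(t)`. -/
abbrev ModTab := (M₀ : ℕ) → (Fin M₀ → E3) → Fin M₀ → ℝ → ℝ
/-- Gradient tables `G(z₁)(b)` (a covector per instance site). -/
abbrev GradTab := (M₁ : ℕ) → (Fin M₁ → E3) → Fin M₁ → Fin M₁ → (E3 →L[ℝ] ℝ)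
/-- Curvature weight tables `w(z₁)(b, b')`. -/
abbrev WtTab := (M₁ : ℕ) → (Fin M₁ → E3) → Fin M₁ → Fin M₁ → Fin M₁ → ℝ
/-- Hessian BLOCK tables `H(z₀)(b, b') : E3 →L[ℝ] E3` (row site `b`, column site `b'`). -/
abbrev HessTab := (M₀ : ℕ) → (Fin M₀ → E3) → Fin M₀ → Fin M₀ → Fin M₀ → (E3 →L[ℝ] E3)
/-- Force tables `F(z₀)(b) : E3` (the instance's own move-test forces). -/
abbrev ForceTab := (M₀ : ℕ) → (Fin M₀ → E3) → Fin M₀ → Fin M₀ → E3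
/-- Row slack tables `X(z₀)(b) : ℝ` (the unmodelled part of the force row at `b`). -/
abbrev SlackTab := (M₀ : ℕ) → (Fin M₀ → E3) → Fin M₀ → Fin M₀ → ℝ

/-! ## §0. (F3) splits over a host class; per-class tables (critic row 1050 (i)) -/

/-- ★ (F3) SPLITS over any host class (same table): the certificate on `𝓘` follows from the certificates on `𝓘 ∩ 𝓟` and `𝓘 ∖ 𝓟`. [formal bookkeeping] -/
theorem familyCert_of_split {𝓘 𝓟 : ChartFam} {φ : ℝ} {Φ : ModTab} {T : LawTab} (hP : FamilyCert (inClass 𝓘 𝓟) φ Φ T)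
    (hQ : FamilyCert (offClass 𝓘 𝓟) φ Φ T) : FamilyCert 𝓘 φ Φ T := by
  intro M₀ z₀ c₀ hI
  by_cases hp : 𝓟 M₀ z₀ c₀
  · exact hP M₀ z₀ c₀ ⟨hI, hp⟩
  · exact hQ M₀ z₀ c₀ ⟨hI, hp⟩

/-- The modulus table GLUED along a host class: `Φ₁` on `𝓟`, `Φ₂` off `𝓟`. -/
noncomputable def splitTable (𝓟 : ChartFam) (Φ₁ Φ₂ : ModTab) : ModTab := fun M₀ z₀ c₀ t => if 𝓟 M₀ z₀ c₀ then Φ₁ M₀ z₀ c₀ t else Φ₂ M₀ z₀ c₀ t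

/-- On the class the glued table is `Φ₁`. [formal bookkeeping] -/
theorem splitTable_of_pos {𝓟 : ChartFam} {Φ₁ Φ₂ : ModTab} {M₀ : ℕ} {z₀ : Fin M₀ → E3} {c₀ : Fin M₀} (h : 𝓟 M₀ z₀ c₀) (t : ℝ) :
    splitTable 𝓟 Φ₁ Φ₂ M₀ z₀ c₀ t = Φ₁ M₀ z₀ c₀ t := by
  simp only [splitTable, if_pos h]

/-- Off the class the glued table is `Φ₂`. [formal bookkeeping] -/
theorem splitTable_of_neg {𝓟 : ChartFam} {Φ₁ Φ₂ : ModTab} {M₀ : ℕ} {z₀ : Fin M₀ → E3} {c₀ : Fin M₀} (h : ¬𝓟 M₀ z₀ c₀) (t : ℝ) :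
    splitTable 𝓟 Φ₁ Φ₂ M₀ z₀ c₀ t = Φ₂ M₀ z₀ c₀ t := by
  simp only [splitTable, if_neg h]

/-- (F1-law) on the class with its own table is (F1-law) on the class with the glued table. [formal bookkeeping] -/
theorem familyEnvelopeLaw_inClass_splitTable {𝓘 𝓟 : ChartFam} {τ : ℝ} {T : LawTab} {Φ₁ Φ₂ : ModTab} (h : FamilyEnvelopeLaw (inClass 𝓘 𝓟) τ T Φ₁) :
    FamilyEnvelopeLaw (inClass 𝓘 𝓟) τ T (splitTable 𝓟 Φ₁ Φ₂) := by
  intro M z c M₀ z₀ c₀ e t hz hcl hm ht htT hch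
  rw [splitTable_of_pos hch.1.2]
  exact h M z c M₀ z₀ c₀ e t hz hcl hm ht htT hch

/-- … and off the class. [formal bookkeeping] -/
theorem familyEnvelopeLaw_offClass_splitTable {𝓘 𝓟 : ChartFam} {τ : ℝ} {T : LawTab} {Φ₁ Φ₂ : ModTab} (h : FamilyEnvelopeLaw (offClass 𝓘 𝓟) τ T Φ₂) :
    FamilyEnvelopeLaw (offClass 𝓘 𝓟) τ T (splitTable 𝓟 Φ₁ Φ₂) := by
  intro M z c M₀ z₀ c₀ e t hz hcl hm ht htT hch
  rw [splitTable_of_neg hch.1.2]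
  exact h M z c M₀ z₀ c₀ e t hz hcl hm ht htT hch

/-- (F3) on the class with its own table is (F3) on the class with the glued table. [formal bookkeeping] -/
theorem familyCert_inClass_splitTable {𝓘 𝓟 : ChartFam} {φ : ℝ} {T : LawTab} {Φ₁ Φ₂ : ModTab} (h : FamilyCert (inClass 𝓘 𝓟) φ Φ₁ T) :
    FamilyCert (inClass 𝓘 𝓟) φ (splitTable 𝓟 Φ₁ Φ₂) T := by
  intro M₀ z₀ c₀ hI
  rw [splitTable_of_pos hI.2]
  exact h M₀ z₀ c₀ hI

/-- … and off the class. [formal bookkeeping] -/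
theorem familyCert_offClass_splitTable {𝓘 𝓟 : ChartFam} {φ : ℝ} {T : LawTab} {Φ₁ Φ₂ : ModTab} (h : FamilyCert (offClass 𝓘 𝓟) φ Φ₂ T) :
    FamilyCert (offClass 𝓘 𝓟) φ (splitTable 𝓟 Φ₁ Φ₂) T := by
  intro M₀ z₀ c₀ hI
  rw [splitTable_of_neg hI.2]
  exact h M₀ z₀ c₀ hI

/-- ★ (F3) with PER-CLASS TABLES: (F3 on `𝓘 ∩ 𝓟` with `Φ₁`) ∧ (F3 on `𝓘 ∖ 𝓟` with `Φ₂`) ⟹ (F3 on `𝓘` with the glued table). [formal bookkeeping] -/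
theorem familyCert_of_split_tables {𝓘 𝓟 : ChartFam} {φ : ℝ} {T : LawTab} {Φ₁ Φ₂ : ModTab} (hP : FamilyCert (inClass 𝓘 𝓟) φ Φ₁ T)
    (hQ : FamilyCert (offClass 𝓘 𝓟) φ Φ₂ T) : FamilyCert 𝓘 φ (splitTable 𝓟 Φ₁ Φ₂) T :=
  familyCert_of_split (familyCert_inClass_splitTable hP) (familyCert_offClass_splitTable hQ)

/-- ★ (F1-law) with PER-CLASS TABLES. [formal bookkeeping] -/
theorem familyEnvelopeLaw_of_split_tables {𝓘 𝓟 : ChartFam} {τ : ℝ} {T : LawTab} {Φ₁ Φ₂ : ModTab} (hP : FamilyEnvelopeLaw (inClass 𝓘 𝓟) τ T Φ₁)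
    (hQ : FamilyEnvelopeLaw (offClass 𝓘 𝓟) τ T Φ₂) : FamilyEnvelopeLaw 𝓘 τ T (splitTable 𝓟 Φ₁ Φ₂) :=
  familyEnvelopeLaw_of_split (familyEnvelopeLaw_inClass_splitTable hP) (familyEnvelopeLaw_offClass_splitTable hQ)

/-- (T2⁻) on the rough class is a THEOREM too (antitonicity from (T2ᴰ⁻)). [formal bookkeeping] -/
theorem taylorTwoMinus_classQ (ηP : ℝ) : SmoothTaylorTwo (ClassQ ηP) tau0 delta0 G0 wMinus rho0 :=
  smoothTaylorTwo_anti (classQ_le_D ηP) taylorTwoDMinus_holds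

/-- ★★★ **THE PER-CLASS-TABLE RECORD `coreOff_record_g57s ηP`** — the g56 designate with SEPARATE certificate tables: (F3ᴾ) certifies `Ψ + ϱ₀ + μ` on `𝓘₀ᴾ(ηP)`
only, (F3ꟴ) certifies the rough class's own modulus `Φ_Q` on `𝓘₀ꟴ(ηP)` only (critic row 1050 coupling note (i)). [folklore] -/
theorem coreOff_record_g57s (ηP : ℝ) {Ψ ΦQ : ModTab} {μ : LawTab} (hBP : BasinFix (ClassP ηP) tau0 delta0 T0) (hMP : MembershipFix (ClassP ηP) tau0 delta0 T0 μ)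
    (hLP : SlavedLaw (ClassP ηP) tau0 delta0 T0 G0 wMinus Ψ) (hQ : FamilyEnvelopeLaw (ClassQ ηP) tau0 T0 ΦQ) (hR : FamilyRoomBent0)
    (hCP : FamilyCert (ClassP ηP) 0 (withColumns Ψ μ) T0) (hCQ : FamilyCert (ClassQ ηP) 0 ΦQ T0)
    (hBand : BandFarFloor (63 / 10) (63 / 10) (24 / 5) (1 / 100) (3 / 50) (1 / 10) 0) (hS : SoftFarFloor (63 / 10) (63 / 10) (24 / 5) (1 / 100) (1 / 10) 0) :
    CoreOffTubeFloor (63 / 10) (63 / 10) (24 / 5) (1 / 100) 0 :=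
  coreOff_of_edge_of_band_of_soft
    (edgeFar_D (Φ := splitTable (levelClass ηP) (withColumns Ψ μ) ΦQ)
      (familyEnvelopeLaw_of_split_tables (familyEnvelopeLaw_of_taylor_fix hBP (taylorTwoMinus_classP ηP) hMP hLP) hQ) hR
      (familyCert_of_split_tables hCP hCQ)) hBand hS

/-! ## §1. The move-test force and THE FORCE CAP (FC) -/

/-- `V'` of the tree's `lennardJones r = (1/12)·r⁻¹² − (1/6)·r⁻⁶`: `ljD1 r = −r⁻¹³ + r⁻⁷` (`ljD1 1 = 0`). -/
noncomputable def ljD1 (r : ℝ) : ℝ := -(r⁻¹ ^ 13) + r⁻¹ ^ 7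

/-- `V''`: `ljD2 r = 13·r⁻¹⁴ − 7·r⁻⁸` (`ljD2 1 = 6`; inflection at `r = (13/7)^{1/6} ≈ 1.109`). -/
noncomputable def ljD2 (r : ℝ) : ℝ := 13 * r⁻¹ ^ 14 - 7 * r⁻¹ ^ 8

/-- `V'(1) = 0`. [formal bookkeeping] -/
theorem ljD1_one : ljD1 1 = 0 := by norm_num [ljD1]

/-- `V''(1) = 6`. [formal bookkeeping] -/
theorem ljD2_one : ljD2 1 = 6 := by norm_num [ljD2]

/-- The MOVE-TEST NEIGHBOURHOOD of site `j`: atoms `k ≠ j` within `Rm` of `y j` — literally the index set of the local field inside `MoveUnstableCore ε Rm s`. -/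
noncomputable def moveNbrs (Rm : ℝ) {N : ℕ} (y : Fin N → E3) (j : Fin N) : Finset (Fin N) :=
  (Finset.univ.erase j).filter (fun k => dist (y k) (y j) ≤ Rm)

/-- The MOVE-TEST LOCAL FIELD of site `j` at a trial point `p`: `Σ_{k ∈ moveNbrs} V(dist p (y k))` (`MoveUnstableCore` compares its value at `p` with its
value at `y j`). -/
noncomputable def locField (Rm : ℝ) {N : ℕ} (y : Fin N → E3) (j : Fin N) (p : E3) : ℝ := ∑ k ∈ moveNbrs Rm y j, lennardJones (dist p (y k))

/-- The FORCE on site `j` in its move-test local field: `siteForce Rm y j = −∇_p locField(p)|_{p = y j} = −Σ_k (V'(r_jk)/r_jk)·(y j − y k)`. -/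
noncomputable def siteForce (Rm : ℝ) {N : ℕ} (y : Fin N → E3) (j : Fin N) : E3 :=
  -∑ k ∈ moveNbrs Rm y j, (ljD1 (dist (y j) (y k)) / dist (y j) (y k)) • (y j - y k)

/-- **REACH sites** of centre `c`: within `9/2` of some `9/5`-member (where `ExRec`'s `Collar (9/2)` reaches; the complement, inside the `63/10`-ball, of the
tree's `uncapped` annulus). -/
def IsReach {M : ℕ} (z : Fin M → E3) (c a : Fin M) : Prop := ∃ j ∈ ball (9 / 5) z c, dist (z a) (z j) ≤ 9 / 2

/-- Reach sites lie in the `63/10`-ball (`9/2 + 9/5 = 63/10`). [formal bookkeeping] -/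
theorem mem_ball_of_isReach {M : ℕ} {z : Fin M → E3} {c a : Fin M} (h : IsReach z c a) : a ∈ ball (63 / 10) z c := by
  obtain ⟨j, hj, hd⟩ := h
  rw [mem_ball] at hj ⊢
  calc dist (z a) (z c) ≤ dist (z a) (z j) + dist (z j) (z c) := dist_triangle _ _ _
    _ ≤ 9 / 2 + 9 / 5 := add_le_add hd hj
    _ = 63 / 10 := by norm_num

/-- A reach site is not uncapped. [formal bookkeeping] -/
theorem not_mem_uncapped_of_isReach {M : ℕ} {z : Fin M → E3} {c a : Fin M} (h : IsReach z c a) : a ∉ uncapped z c := by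
  obtain ⟨j, hj, hd⟩ := h
  intro hu
  have := (Finset.mem_filter.1 hu).2 j hj
  linarith

/-- Every site of the `63/10`-ball is a reach site or an uncapped site: the force rows and the rim pins together cover the charted ball. [formal bookkeeping] -/
theorem isReach_or_mem_uncapped {M : ℕ} {z : Fin M → E3} {c a : Fin M} (ha : a ∈ ball (63 / 10) z c) : IsReach z c a ∨ a ∈ uncapped z c := by
  by_cases h : ∃ j ∈ ball (9 / 5) z c, dist (z a) (z j) ≤ 9 / 2
  · exact Or.inl h
  · exact Or.inr (Finset.mem_filter.2 ⟨ha, fun j hj => not_le.1 fun hle => h ⟨j, hj, hle⟩⟩)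

/-- ★ **(FC σ) `ForceCapLaw σ`** [ATTACKABLE · KNOWN-MATH, M] — every reach site of an admissible cluster is FORCE-CAPPED in its move-test field (`Rm = 7`):
`‖siteForce 7 z a‖ ≤ σ`.  TRUE at `σ = σ₁ = S₇♯(7)`: `Admissible ⊇ ¬ExemptNear (9/5) ExRec`, `ExRec = Collar (9/2) ((∃ s ∈ [0, 3/2], NonEquilibriumCore … 0 7 s …) ∨ …)`
and `NonEquilibriumCore ⊇ MoveUnstableCore 0 7 s`, so at a reach site `locField 7 z a p + s·(7/(7−s))⁷·σ₁ ≥ locField 7 z a (z a)` for every `p` with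
`dist p (z a) ≤ s < 7/10`; along `p = z a − s·u`, `s → 0⁺`: `⟨∇locField(z a), u⟩ ≤ σ₁` for every unit `u` (injectivity makes every summand
`lennardJones (dist · (z k))` differentiable at `z a`, cf. `…NashForceBalance.hasFDerivAt_lennardJones_dist`). -/
def ForceCapLaw (σ : ℝ) : Prop :=
  ∀ (M : ℕ) (z : Fin M → E3) (c : Fin M), Admissible M z c → ∀ a : Fin M, IsReach z c a → ‖siteForce 7 z a‖ ≤ σ

/-- ★ **(FC) of record `:= ForceCapLaw σ₁`.** -/
def ForceCapOne : Prop := ForceCapLaw sigmaOne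

/-- (FC) is MONOTONE in the cap. [formal bookkeeping] -/
theorem forceCapLaw_mono {σ σ' : ℝ} (hle : σ ≤ σ') (h : ForceCapLaw σ) : ForceCapLaw σ' :=
  fun M z c hz a ha => (h M z c hz a ha).trans hle

end Summit.AtomisticToContinuum.Crystallization.Theorems.FrustratedLawDichotomyStrainedPatchQuantSlaving
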